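import Summits.AtomisticToContinuum.Crystallization.Theorems.PricedLinkCensusLocalToGlobalFccMirrorLatticeField
import Summits.AtomisticToContinuum.Crystallization.Theorems.PricedLinkCensusLocalToGlobalFccMirrorWall

/-!
# The candidate confined flux of the method of images is admissible

Route `PricedLinkCensus`, crux `LocalToGlobal` (stmt-AtomisticToContinuum-14232), line
`flux-cell-joint-census`, support for the registered stub `stub_fccMirrorExact : NewtonShell8 → FccMirrorExact`
(`Theorems/PricedLinkCensusLocalToGlobalDefs`), second half (`fluxCell ≤ S₆`).  For the canonical data — cell
`V = fccVoronoi a`, centre `0`, smearing radius `a/2`, zero transfer — THE CANDIDATE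

  `mirrorFlux a = 𝟙_{V × ℝ⁵} · latticeField a`

(the field of the infinite lattice of smeared unit charges, restricted to the tube,
`PricedLinkCensusLocalToGlobalFccMirrorLatticeField`) IS AN ADMISSIBLE CONFINED FLUX:
`mirrorFlux a ∈ admissible V 0 (a/2) 0` (registered sub-goal `fccMirror_candidate_admissible`).  Namely
(i) the tube is the polyhedral tube of the twelve minimal vectors, `V × ℝ⁵ = {z : ⟪z, ι wₘ⟫ < a²/2, m ∈ fccInt}`
(`PricedLinkCensusLocalToGlobalFccMirrorCell`); (ii) `mirrorFlux a ∈ L²(ℝ⁸)` by the transverse decay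
`‖latticeField a z‖ ≤ C(1 + ‖perp z‖)⁻³` on the slab and the slab integrability of
`PricedLinkCensusLocalToGlobalThomsonEscapeProfile`; (iii) the weak identity
`∫_{V×ℝ⁵} ⟪latticeField a, ∇φ⟫ = -⨍_{B(0,a/2)} φ` for ALL tests is the wall lemma
(`PricedLinkCensusLocalToGlobalFccMirrorWall`) fed with the mirror symmetry (tangency at the twelve facet
planes) and the Gauss law for tests supported in the tube.

References: W. Thomson (Lord Kelvin), method of images (1848); E. H. Lieb, M. Loss, *Analysis* (2001),
§9.7, §11.15; folklore.
-/

noncomputable section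

open MeasureTheory Set Filter Metric Topology InnerProductSpace Function Literature.Geometry.DiscreteGeometry
open scoped RealInnerProductSpace BigOperators

namespace Summit.AtomisticToContinuum.Crystallization.Theorems.PricedLinkCensusLocalToGlobal

variable {a : ℝ}

/-! ### The tube over the cell is a polyhedral tube -/

/-- The twelve wall vectors `ι((a/√2) m)`, `m ∈ fccInt`, of `ℝ⁸`. [folklore] -/
def wallVec (a : ℝ) (m : Fin 3 → ℤ) : E8 := emb ((a / Real.sqrt 2) • intVec m)

/-- **`V × ℝ⁵ = {z : ⟪z, ι wₘ⟫ < a²/2, m ∈ fccInt}`** (`a > 0`). [folklore] -/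
theorem tube_fccVoronoi_eq (ha : 0 < a) :
    tube (fccVoronoi a) = {z : E8 | ∀ m ∈ fccInt, ⟪z, wallVec a m⟫ < a ^ 2 / 2} := by
  ext z
  show proj z ∈ fccVoronoi a ↔ _
  rw [mem_fccVoronoi_iff ha, mem_setOf_eq]
  refine forall₂_congr fun m _ => ?_
  rw [wallVec, inner_emb_right]
  constructor <;> intro h <;> linarith

/-- The wall vectors are nonzero. [folklore] -/
theorem wallVec_ne_zero (ha : 0 < a) {m : Fin 3 → ℤ} (hm : m ∈ fccInt) : wallVec a m ≠ 0 := fun h => by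
  have h1 : ‖wallVec a m‖ = a := by rw [wallVec, norm_emb, norm_smul_intVec_of_mem_fccInt ha hm]
  rw [h, norm_zero] at h1
  exact ha.ne h1

/-- **Tangency at the walls**: `⟪latticeField a z, ι wₘ⟫ = 0` where `⟪z, ι wₘ⟫ = a²/2`. [folklore] -/
theorem latticeField_tangent (ha : 0 < a) {m : Fin 3 → ℤ} (hm : m ∈ fccInt) {z : E8}
    (hz : ⟪z, wallVec a m⟫ = a ^ 2 / 2) : ⟪latticeField a z, wallVec a m⟫ = 0 := by
  have hwa := norm_smul_intVec_of_mem_fccInt ha hm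
  refine inner_latticeField_emb_eq_zero ha (smul_intVec_mem_fccSet_of_mem_fccInt a hm) hwa ?_
  rw [wallVec, inner_emb_right] at hz
  rw [hwa, hz]
  ring

/-! ### The candidate and its admissibility -/

/-- THE CANDIDATE CONFINED FLUX OF THE METHOD OF IMAGES: the field of images restricted to the tube. [folklore] -/
def mirrorFlux (a : ℝ) (z : E8) : E8 := (tube (fccVoronoi a)).indicator (latticeField a) z

/-- The candidate is a.e.-strongly measurable. [folklore] -/
theorem aestronglyMeasurable_mirrorFlux (ha : 0 < a) : AEStronglyMeasurable (mirrorFlux a) volume :=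
  ((continuous_latticeField ha).aestronglyMeasurable).indicator (isOpen_tube_fccVoronoi ha).measurableSet

/-- **The candidate is square integrable** (transverse decay `(1 + ‖perp z‖)⁻³` over the bounded cell). [folklore] -/
theorem memLp_mirrorFlux (ha : 0 < a) : MemLp (mirrorFlux a) 2 volume := by
  obtain ⟨C, hC0, hC⟩ := exists_norm_latticeField_le_slab ha
  have hbound : ∀ z, ‖mirrorFlux a z‖ ≤ (ball (0 : E3) a).indicator (fun _ => C) (proj z) * (1 + ‖perpL z‖)⁻¹ ^ 3 :=
    fun z => by
    by_cases hz : z ∈ tube (fccVoronoi a)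
    · have hpz : proj z ∈ ball (0 : E3) a := mem_ball_zero_iff.2 (norm_lt_of_mem_fccVoronoi ha hz)
      rw [mirrorFlux, indicator_of_mem hz, indicator_of_mem hpz]
      exact hC z (le_of_lt (mem_ball_zero_iff.1 hpz))
    · rw [mirrorFlux, indicator_of_notMem hz, norm_zero]
      exact mul_nonneg (indicator_nonneg (fun _ _ => hC0) _) (by positivity)
  have hMm : AEStronglyMeasurable (fun z : E8 => (ball (0 : E3) a).indicator (fun _ => C) (proj z) *
      (1 + ‖perpL z‖)⁻¹ ^ 3) volume := by
    refine Measurable.aestronglyMeasurable (Measurable.mul ?_ ?_)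
    · exact (measurable_const.indicator measurableSet_ball).comp (projL : E8 →L[ℝ] E3).continuous.measurable
    · exact (measurable_const.add (perpL : E8 →L[ℝ] E8).continuous.measurable.norm).inv.pow_const 3
  have hM2 : MemLp (fun z : E8 => (ball (0 : E3) a).indicator (fun _ => C) (proj z) * (1 + ‖perpL z‖)⁻¹ ^ 3) 2 volume := by
    rw [memLp_two_iff_integrable_sq hMm]
    have hint := integrable_slab_weight 0 a (C ^ 2) (by norm_num : (5 : ℝ) < 6)
    refine hint.congr (Eventually.of_forall fun z => ?_)
    have h6 : ((1 + ‖perpL z‖)⁻¹ ^ 3) ^ 2 = (1 + ‖perpL z‖) ^ (-(6 : ℝ)) := by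
      rw [← pow_mul, Real.rpow_neg (by positivity), inv_pow, show ((6 : ℝ)) = ((6 : ℕ) : ℝ) by norm_num,
        Real.rpow_natCast]
    simp only
    rw [← h6]
    by_cases hz : proj z ∈ ball (0 : E3) a
    · rw [indicator_of_mem hz, indicator_of_mem hz]; ring
    · rw [indicator_of_notMem hz, indicator_of_notMem hz]; ring
  refine MemLp.of_le hM2 (aestronglyMeasurable_mirrorFlux ha) (Eventually.of_forall fun z => ?_)
  rw [Real.norm_eq_abs]
  exact (hbound z).trans (le_abs_self _)

/-- **The weak identity of the candidate**: `∫_{V×ℝ⁵} ⟪latticeField a, ∇φ⟫ = -⨍_{B(0,a/2)} φ` for EVERY test `φ`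
(the wall lemma). [folklore] -/
theorem setIntegral_inner_latticeField (ha : 0 < a) {φ : E8 → ℝ} (hφ : IsTest φ) :
    ∫ z in tube (fccVoronoi a), ⟪latticeField a z, gradient φ z⟫ = -⨍ z in ball (0 : E8) (a / 2), φ z := by
  rw [tube_fccVoronoi_eq ha]
  refine setIntegral_inner_gradient_of_tangent (M := fccInt) (W := wallVec a) (α := fun _ => a ^ 2 / 2)
    (fun m hm => wallVec_ne_zero ha hm) (continuous_latticeField ha) (fun m hm z hz => latticeField_tangent ha hm hz)
    ?_ (fun Φ hΦ hts => ?_) hφ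
  · rw [← tube_fccVoronoi_eq ha]; exact ball_zero_subset_tube a
  · rw [← tube_fccVoronoi_eq ha] at hts
    exact integral_inner_latticeField_gradient ha hΦ hts

/-- **THE CANDIDATE IS ADMISSIBLE**: `mirrorFlux a ∈ admissible (fccVoronoi a) 0 (a/2) 0`. [folklore] -/
theorem mirrorFlux_mem_admissible (ha : 0 < a) : mirrorFlux a ∈ admissible (fccVoronoi a) 0 (a / 2) (fun _ => 0) := by
  refine ⟨memLp_mirrorFlux ha, fun z hz => indicator_of_notMem hz _, fun φ hφ => ?_⟩
  have h1 : ∫ z in tube (fccVoronoi a), ⟪mirrorFlux a z - 0, gradient φ z⟫ =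
      ∫ z in tube (fccVoronoi a), ⟪latticeField a z, gradient φ z⟫ :=
    setIntegral_congr_fun (isOpen_tube_fccVoronoi ha).measurableSet fun z hz => by
      rw [sub_zero, mirrorFlux, indicator_of_mem hz]
  rw [h1, setIntegral_inner_latticeField ha hφ, emb_zero]

/-- **Registered sub-goal `fccMirror_candidate_admissible`** (line `flux-cell-joint-census`, support of
`stub_fccMirrorExact`): admissibility of the candidate confined flux of the method of images, binder form of
`mirrorFlux_mem_admissible`. [folklore] -/
theorem fccMirror_candidate_admissible : ∀ (a : ℝ), 0 < a →
    mirrorFlux a ∈ admissible (fccVoronoi a) 0 (a / 2) (fun _ => 0) :=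
  fun _ ha => mirrorFlux_mem_admissible ha

end Summit.AtomisticToContinuum.Crystallization.Theorems.PricedLinkCensusLocalToGlobal

end
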